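import Summits.Ventures.HSemireg.WedgeHankelBoxSiegelIdeal

/-!
# Venture HSemireg — THE BOX SIEGEL IDEAL is the TWO-SIDED IDEAL generated by gen 10's `SiegelBox`: `boxSiegelIdeal_{k+2} = ⋀^k ∧ SiegelBox = SiegelBox ∧ ⋀^k`,
# `⋀^a ∧ boxSiegelIdeal_k ≤ boxSiegelIdeal_{a+k}`, `boxSiegelIdeal_k ∧ ⋀^a ≤ boxSiegelIdeal_{k+a}`

HONEST FRAMING. Part of the Lean index of the computation cell `pub-hsemireg` (seat p10 gen 12, Sunday typer «UNIFORM-IN-n»).  Finite-dimensional EXTERIOR ALGEBRA over a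
field ONLY; nothing here says that HC / HC_CM / HC_AV holds; no Literature fact is declared or used.  Custodian versions as in `WedgeHankelBoxSiegelIdeal` (1/3); dictionary QUOTED.

THIS FILE (namespace `Summit.Ventures.HSemireg.Wedge.HankelBoxSiegelIdeal` continued; imports (1/3) only): the submodule-product description of the box Siegel ideal (one
factor: gen 11 #8 §14 `exteriorPower_mul_siegel`):
* **`boxSiegelIdeal_eq_exteriorPower_mul`: `boxSiegelIdeal_{k+2} = ⋀^k ∧ SiegelBox`** and **`boxSiegelIdeal_eq_mul_exteriorPower`: `= SiegelBox ∧ ⋀^k`** (the embedded Siegel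
  2-vectors are even, hence commute with every monomial); `boxSiegelIdeal_lt_two`: the degrees `0, 1` are zero;
* **`exteriorPower_mul_boxSiegelIdeal_le` / `boxSiegelIdeal_mul_exteriorPower_le`: `⋀^a ∧ boxSiegelIdeal_k ≤ boxSiegelIdeal_{a+k}`, `boxSiegelIdeal_k ∧ ⋀^a ≤
  boxSiegelIdeal_{k+a}`** — `⊕_k boxSiegelIdeal_k` is the two-sided (homogeneous) ideal of `⋀(K^{Σ 2m_i})` generated by `SiegelBox`;
* **`boxSiegelIdeal_mul_boxSiegelIdeal_le`: `boxSiegelIdeal_j ∧ boxSiegelIdeal_k ≤ boxSiegelIdeal_{j+k}`.**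
Class side only.
-/

open Module

namespace Summit.Ventures.HSemireg.Wedge.HankelBoxSiegelIdeal

open Summit.Ventures.HSemireg.Wedge Summit.Ventures.HSemireg.Wedge.Kunneth Summit.Ventures.HSemireg.Wedge.MixedBox
  Summit.Ventures.HSemireg.Wedge.HankelSiegel Summit.Ventures.HSemireg.Wedge.HankelSiegelIdeal
  Summit.Ventures.HSemireg.Wedge.HankelBox

variable (K : Type*) [Field K] {n : ℕ} (m : Fin n → ℕ)

/-- `⋀^k` is spanned by the monomials of cardinality `k` (box generator type). -/
lemma exteriorPower_eq_span_B (k : ℕ) :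
    (⋀[K]^k (Gen m → K) : Submodule K (HT K (Gen m))) = Submodule.span K ((fun t : Finset (Gen m) => B K (Gen m) t) '' {t | t.card = k}) :=
  exteriorPower_eq_span K k

/-- **`boxSiegelIdeal_{k+2} = ⋀^k ∧ SiegelBox`**: the degree-`(k+2)` part of the box Siegel ideal is the submodule product of the `k`-forms with gen 10's product Siegel
space. -/
theorem boxSiegelIdeal_eq_exteriorPower_mul (k : ℕ) :
    boxSiegelIdeal K m (k + 2) = (⋀[K]^k (Gen m → K) : Submodule K (HT K (Gen m))) * siegelBox K m := by
  rw [boxSiegelIdeal_eq_span, exteriorPower_eq_span_B, siegelBox, Submodule.span_mul_span]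
  apply le_antisymm
  · rw [Submodule.span_le]
    rintro _ ⟨⟨t, x⟩, hk, rfl⟩
    exact Submodule.subset_span ⟨_, ⟨t, by simp only [Set.mem_setOf_eq] at hk ⊢; omega, rfl⟩, _, ⟨x, rfl⟩, rfl⟩
  · rw [Submodule.span_le]
    rintro _ ⟨_, ⟨t, ht, rfl⟩, _, ⟨x, rfl⟩, rfl⟩
    exact Submodule.subset_span ⟨(t, x), by simp only [Set.mem_setOf_eq] at ht ⊢; omega, rfl⟩

/-- **`boxSiegelIdeal_{k+2} = SiegelBox ∧ ⋀^k`** as well (the embedded Siegel 2-vectors commute with every monomial). -/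
theorem boxSiegelIdeal_eq_mul_exteriorPower (k : ℕ) :
    boxSiegelIdeal K m (k + 2) = siegelBox K m * (⋀[K]^k (Gen m → K) : Submodule K (HT K (Gen m))) := by
  rw [boxSiegelIdeal_eq_exteriorPower_mul]
  refine Submodule.mul_comm_of_commute fun θ hθ s hs => ?_
  rw [exteriorPower_eq_span_B] at hθ
  rw [siegelBox] at hs
  -- both sides are spans; commute generator by generator, then extend bilinearly
  induction hs using Submodule.span_induction generalizing θ with
  | mem y hy =>
    obtain ⟨x, rfl⟩ := hy
    induction hθ using Submodule.span_induction with
    | mem z hz => obtain ⟨t, -, rfl⟩ := hz; exact B_mul_bsgen_comm K m t x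
    | zero => exact Commute.zero_left _
    | add a c _ _ ha hc => exact Commute.add_left ha hc
    | smul r a _ ha => exact Commute.smul_left ha r
  | zero => exact Commute.zero_right _
  | add a c _ _ ha hc => exact Commute.add_right (ha θ hθ) (hc θ hθ)
  | smul r a _ ha => exact Commute.smul_right (ha θ hθ) r

/-- the box Siegel ideal has nothing in degrees `0` and `1`. -/
theorem boxSiegelIdeal_lt_two {k : ℕ} (hk : k < 2) : boxSiegelIdeal K m k = ⊥ := by
  rw [boxSiegelIdeal_eq_span, Submodule.span_eq_bot]
  rintro _ ⟨p, hp, rfl⟩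
  simp only [Set.mem_setOf_eq] at hp
  omega

/-- **LEFT IDEAL: `⋀^a ∧ boxSiegelIdeal_k ≤ boxSiegelIdeal_{a+k}`.** -/
theorem exteriorPower_mul_boxSiegelIdeal_le (a k : ℕ) :
    (⋀[K]^a (Gen m → K) : Submodule K (HT K (Gen m))) * boxSiegelIdeal K m k ≤ boxSiegelIdeal K m (a + k) := by
  rw [exteriorPower_eq_span_B, boxSiegelIdeal_eq_span, boxSiegelIdeal_eq_span, Submodule.span_mul_span, Submodule.span_le]
  rintro _ ⟨_, ⟨s, hs, rfl⟩, _, ⟨⟨t, x⟩, hk, rfl⟩, rfl⟩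
  simp only [Set.mem_setOf_eq] at hs hk
  show B K (Gen m) s * (B K (Gen m) t * bsgen K m x) ∈ _
  rw [← mul_assoc, B_mul_B, smul_mul_assoc]
  by_cases hst : Disjoint s t
  · refine Submodule.smul_mem _ _ (Submodule.subset_span ⟨(_, x), ?_, rfl⟩)
    simp only [Set.mem_setOf_eq]
    rw [card_union_of_disjoint' hst]
    omega
  · rw [u_eq_zero K hst, zero_smul]
    exact Submodule.zero_mem _

/-- **RIGHT IDEAL: `boxSiegelIdeal_k ∧ ⋀^a ≤ boxSiegelIdeal_{k+a}`** (commute the monomial past the even Siegel 2-vector). -/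
theorem boxSiegelIdeal_mul_exteriorPower_le (k a : ℕ) :
    boxSiegelIdeal K m k * (⋀[K]^a (Gen m → K) : Submodule K (HT K (Gen m))) ≤ boxSiegelIdeal K m (k + a) := by
  rw [exteriorPower_eq_span_B, boxSiegelIdeal_eq_span, boxSiegelIdeal_eq_span, Submodule.span_mul_span, Submodule.span_le]
  rintro _ ⟨_, ⟨⟨t, x⟩, hk, rfl⟩, _, ⟨s, hs, rfl⟩, rfl⟩
  simp only [Set.mem_setOf_eq] at hs hk
  show B K (Gen m) t * bsgen K m x * B K (Gen m) s ∈ _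
  rw [mul_assoc, ← B_mul_bsgen_comm, ← mul_assoc, B_mul_B, smul_mul_assoc]
  by_cases hts : Disjoint t s
  · refine Submodule.smul_mem _ _ (Submodule.subset_span ⟨(_, x), ?_, rfl⟩)
    simp only [Set.mem_setOf_eq]
    rw [card_union_of_disjoint' hts]
    omega
  · rw [u_eq_zero K hts, zero_smul]
    exact Submodule.zero_mem _

/-- **`boxSiegelIdeal_j ∧ boxSiegelIdeal_k ≤ boxSiegelIdeal_{j+k}`** (the box Siegel ideal lies in `⋀^j`). -/
theorem boxSiegelIdeal_mul_boxSiegelIdeal_le (j k : ℕ) : boxSiegelIdeal K m j * boxSiegelIdeal K m k ≤ boxSiegelIdeal K m (j + k) :=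
  (mul_le_mul' (boxSiegelIdeal_le_exteriorPower K m j) le_rfl).trans (exteriorPower_mul_boxSiegelIdeal_le K m j k)

/-- summary: **the family `(boxSiegelIdeal_k)_k` is the two-sided homogeneous ideal generated by `SiegelBox`** — it contains `SiegelBox` (degree 2), is stable under left and
right multiplication by forms, and every degree is reached from `SiegelBox` by left multiplication with `⋀^{k−2}`. -/
theorem boxSiegelIdeal_twoSided (k : ℕ) :
    siegelBox K m = boxSiegelIdeal K m 2 ∧
    (∀ a, (⋀[K]^a (Gen m → K) : Submodule K (HT K (Gen m))) * boxSiegelIdeal K m k ≤ boxSiegelIdeal K m (a + k)) ∧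
    (∀ a, boxSiegelIdeal K m k * (⋀[K]^a (Gen m → K) : Submodule K (HT K (Gen m))) ≤ boxSiegelIdeal K m (k + a)) ∧
    boxSiegelIdeal K m (k + 2) = (⋀[K]^k (Gen m → K) : Submodule K (HT K (Gen m))) * siegelBox K m :=
  ⟨(boxSiegelIdeal_two K m).symm, fun a => exteriorPower_mul_boxSiegelIdeal_le K m a k, fun a => boxSiegelIdeal_mul_exteriorPower_le K m k a,
    boxSiegelIdeal_eq_exteriorPower_mul K m k⟩

end Summit.Ventures.HSemireg.Wedge.HankelBoxSiegelIdeal
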